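import Literature.MathematicalPhysics.QuantumFieldTheory.Balaban1983to89.B9Eq315QknitSizesY
import Literature.MathematicalPhysics.QuantumFieldTheory.Balaban1983to89.Node00.OpsYQLetter

/-!
# `Balaban1983to89.B9Eq315QknitSizesRecordY` — T. Bałaban, *Propagators for lattice gauge theories in a background field*, Commun. Math. Phys. **99** (1985) 389–434
# [Balaban1985BackgroundPropagators], (3.12)–(3.15) p. 393 with *Averaging operations …*, CMP **98** (1985) [Balaban1985Averaging], Prop. 4 (130) p. 38: THE SIZE LAW
# (L7) OF NODE 00's Q-LETTER LAW BUNDLE (`Node00/OpsYQLetter.IsBddOnQ`) FOR THE KNIT AVERAGING LETTER OF RECORD `qKnitOfRecord = (i ↦ QknitY i)` ON THE REGIME OF RECORD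
# `regQY G i c₀ α₀` (the member's local class (3.35)), WITH CONSTANT `K = 2` — director-ym ruling №375, obligation (5) «(L7) sizes := n06-c», DISCHARGED BY NAME
# (this seat's `B9Eq315QknitSizesY.norm_QknitY_apply_le_of_reg335P` IS the law unfolded)

statement-level skeleton of published theorems with citation tags; proofs where landed; nothing here is a claim about the Yang–Mills mass gap

THE PRINT.  [B9] (3.12)–(3.15) p. 393 (the averaging operators `Q_j(U)` and their sizes); (3.35) p. 396 (the local regularity class); [5] Prop. 4 (130) p. 38, Prop. 2 p. 26,
p. 24 (locality).

WHY THIS FILE (pub-ymgap node N06 [B9], O5 ∕ R2 re-pin).  node00-def-Y's `Node00/OpsYQLetter` (№375 R2-A step (2), ✓p772635) types the law bundle `QLawsY` of the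
re-pinned averaging letter; its field (L7) is `IsBddOnQ 𝓡 𝔮 K := ∀ U, 𝓡 U → ∀ a ι, ‖𝔮 U a ι‖ ≤ K‖a‖` on the regime of record `regQY G i c α₀ := (bg9KP 𝔸 G i).Reg335 c α₀`,
inhabited there for the straight-contour letter (`isBddOnQ_qYOfRecord`, `K = 1`) and LEFT TO THIS SEAT for the knit letter (docstring: «(L7) for `QknitY` is
dag-n06-c's»).  `B9Eq315QknitSizesY.norm_QknitY_apply_le_of_reg335P` (✓p771760) proves exactly the unfolded statement with `K = 2` under `G ≤ U(N)`, `c₀ ≤ 10`,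
`0 ≤ Mα₀` and the x-free numerics `K_pl(Mα₀)·L⁴ < α₀′`, `C₀α₀′ ≤ 1∕3`, `4α₀′ ≤ c₂′`, `e^{4·800(d+2)²(d+5)α₀′} < 2` (dag-n06-l's `…_of_reg335P` binder shapes plus [5]
Prop. 4's `4α₀′ ≤ c₂′` and the (L4)-shape exponential); THIS FILE folds it into def-Y's names:
* ★★★ `isBddOnQ_QknitY_reg335` — `IsBddOnQ (regQY G i c₀ α₀) (QknitY i) 2` (index level, the twin of def-Y's `isNullOnQ_QknitY_reg335`);
* ★★★ `isBddOnQ_qKnitOfRecord` — the same for the family of record `qKnitOfRecord N θ i` (the twin of def-Y's `isNullOnQ_qKnitOfRecord` ∕ `isBddOnQ_qYOfRecord`),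
  the name dag-n06-d's №375 step-(4) certificate edition consumes for the `QLawsY.bdd` field at `𝔮 := qKnitOfRecord`.

HONEST SCOPE ∕ NOT CLAIMED.  Two one-line folds BY NAME (definitional unfolding of `IsBddOnQ` ∕ `regQY` ∕ `qKnitOfRecord`); no estimate added here (the estimate is
[5] Prop. 4 via `B7Prop4LinCovIterLinearBound`, landed); the regime hypotheses are displayed as in def-Y's (L8) instance; `K = 2` is print's (130) constant, not optimal.
Count-neutral; (L6) (onto) for the knit letter remains OPEN (dag-n06-l lineage); N06 NOT discharged; nothing continuum ∕ OS ∕ mass gap ∕ Clay.  NEW file; 0 `def`, no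
`sorry`, no `axiom`, no `instance`, no `notation`.  Cell `pub-ymgap` (D-0062), seat `pub-ymgap-dag-n06-c` (gen 23), 2026-08-30; `--supports stmt-QuantumFields-27364`.
Net new unproved facts: 0.

RELATED IN THE TREE, NOT DUPLICATED (searched 2026-08-30: `rg` for the basename and the two decl names over `lean/Literature` + `lean/Summits` — 0 hits): node00-def-Y
`Node00/OpsYQLetter` (`IsBddOnQ`, `regQY`, `qKnitOfRecord`, `isBddOnQ_qYOfRecord`, `isNullOnQ_QknitY_reg335`; USED ∕ mirrored), this seat's `B9Eq315QknitSizesY` (USED),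
dag-n06-l `B9Eq3124HZKnitPairReg335Y` (the (3.35) ⟹ (52) retraction behind it).
-/

noncomputable section

namespace Literature.MathematicalPhysics.QuantumFieldTheory.Balaban1983to89.B9Eq315QknitSizesRecordY

open B6KLevelCensusIndexV1 (KIdx kGeo)
open B7Prop2Explicit (unitaryUnits C0 c2')
open B9C2FormBoxRegimeY (Kpl)
open B9Eq3115KnitLetterY (QknitY)
open B9Eq315QknitSizesY (norm_QknitY_apply_le_of_reg335P)
open Node00 (Stage3Params)
open Node00.OpsYQLetter (IsBddOnQ regQY qKnitOfRecord)
open scoped Matrix.Norms.L2Operator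

variable {d ℓ : ℕ} {hd : 1 ≤ d + 1} {hL : Odd (ℓ + 1) ∧ 1 < ℓ + 1} {b₀ b₁ : ℝ} {N : ℕ}

/-- ★★★ **(L7) OF THE Q-LETTER LAW BUNDLE FOR THE KNIT LETTER ON THE REGIME OF RECORD, `K = 2`** (index level): for `G ≤ U(N)`, `c₀ ≤ 10`, `0 ≤ Mα₀` and the x-free
numerics `K_pl(Mα₀)·L⁴ < α₀′`, `C₀α₀′ ≤ 1∕3`, `4α₀′ ≤ c₂′`, `e^{4·800((d+1)+1)²((d+1)+4)α₀′} < 2`: `IsBddOnQ (regQY G i c₀ α₀) (QknitY i) 2` — every background of the member's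
local class (3.35) has `‖(Q̄(U)a)(ι)‖ ≤ 2‖a‖` (this seat's `norm_QknitY_apply_le_of_reg335P`, which IS the law unfolded).
[cite: Balaban1985BackgroundPropagators, (3.12)–(3.15) p.393, (3.35) p.396] [cite: Balaban1985Averaging, Proposition 4 (130) p.38, Prop. 2 p.26, p.24] -/
theorem isBddOnQ_QknitY_reg335 [Nonempty (Fin N)] (i : KIdx d ℓ hd hL b₀ b₁) {G : Subgroup (Matrix (Fin N) (Fin N) ℂ)ˣ}
    (hGU : G ≤ unitaryUnits (Matrix (Fin N) (Fin N) ℂ)) {c₀ α₀ : ℝ} (hc : c₀ ≤ 10) (hMα : 0 ≤ (kGeo i).M * α₀)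
    {α₀' : ℝ} (hα' : 0 < α₀') (hα3 : C0 (d + 1) * α₀' ≤ 1 / 3) (hα4 : 4 * α₀' ≤ c2' (d + 1) (ℓ + 1))
    (hexp : Real.exp (4 * (800 * (((d + 1 : ℕ) : ℝ) + 1) ^ 2 * (((d + 1 : ℕ) : ℝ) + 4)) * α₀') < 2)
    (hK : Kpl i ((kGeo i).M * α₀) * (kGeo i).L ^ 4 < α₀') :
    IsBddOnQ (regQY G i c₀ α₀) (QknitY i) 2 :=
  fun U hU a ι => norm_QknitY_apply_le_of_reg335P i hGU hc hMα hα' hα3 hα4 hexp hK U hU a ι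

/-- ★★★ **(L7) INDEXWISE FOR THE KNIT FAMILY OF RECORD `qKnitOfRecord` ON THE REGIME OF RECORD, `K = 2`** — the `QLawsY.bdd` field at `𝔮 := qKnitOfRecord N θ` for
dag-n06-d's №375 step-(4) certificate edition (twin of node00-def-Y's `isBddOnQ_qYOfRecord` (`K = 1`) and of his `isNullOnQ_qKnitOfRecord`).
[cite: Balaban1985BackgroundPropagators, (3.12)–(3.15) p.393, (3.35) p.396] [cite: Balaban1985Averaging, Proposition 4 (130) p.38] -/
theorem isBddOnQ_qKnitOfRecord {θ : Stage3Params} [Nonempty (Fin N)] {G : Subgroup (Matrix (Fin N) (Fin N) ℂ)ˣ}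
    (hGU : G ≤ unitaryUnits (Matrix (Fin N) (Fin N) ℂ)) {c₀ α₀ : ℝ} (hc : c₀ ≤ 10) (i : KIdx θ.d₆ θ.ℓ₆ θ.hd' θ.hL' θ.b₀ θ.b₁)
    (hMα : 0 ≤ (kGeo i).M * α₀) {α₀' : ℝ} (hα' : 0 < α₀') (hα3 : C0 (θ.d₆ + 1) * α₀' ≤ 1 / 3) (hα4 : 4 * α₀' ≤ c2' (θ.d₆ + 1) (θ.ℓ₆ + 1))
    (hexp : Real.exp (4 * (800 * (((θ.d₆ + 1 : ℕ) : ℝ) + 1) ^ 2 * (((θ.d₆ + 1 : ℕ) : ℝ) + 4)) * α₀') < 2)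
    (hK : Kpl i ((kGeo i).M * α₀) * (kGeo i).L ^ 4 < α₀') :
    IsBddOnQ (regQY G i c₀ α₀) (qKnitOfRecord N θ i) 2 :=
  isBddOnQ_QknitY_reg335 i hGU hc hMα hα' hα3 hα4 hexp hK

end Literature.MathematicalPhysics.QuantumFieldTheory.Balaban1983to89.B9Eq315QknitSizesRecordY

end
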